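import Mathlib
import Literature.Probability.Percolation.PercolationProofs
import Literature.Probability.Percolation.SharpnessDCTProofs
import Literature.Probability.LatticeModels.ProdBernoulliIndependence
import Literature.Probability.LatticeModels.ProdBernoulliClusterLocality
import HarnessLib

/-!
# Crux `PercNearOneGluing.AdditiveGluing` (stmt-CriticalPhenomena-4576), line `replica-splice-at-entrance` —
# stub `stub_pocketMarkov` (spatial Markov property at the entrance stopping set)

Helper file for the crux skeleton of the line `replica-splice-at-entrance` (lead
prover-line-stmt-CriticalPhenomena-4576-c2-0): proves exactly the registered stub signature
`stub_pocketMarkov`; lands with `--supports stmt-CriticalPhenomena-4576`.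

## Content

Fix weights `w : Sym2 (Fin n) → [0, 1]` (`μ_w := prodBernoulli w`, every pair of the complete graph on `Fin n`
open independently), a relay set `A`, a source `o`, a target `b`.  The `A`-AVOIDING POCKET of `o` in `ω` is
`W(ω) = {v | o ↔ v by an open path inside Aᶜ}` and the ENTRANCE SET (first contacts) is
`N(ω) = {a ∈ A | o ↔ a by an open path inside Aᶜ ∪ {a}}`.  For data `(W, N)` let
`P := {W(ω) = W, N(ω) = N}`, `O := ⋃_{a ∈ N} {a ↔ b inside Wᶜ}` and let `w'` be `w` with every pair meeting
`W` given weight `0`.  Then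

`μ_w (P ∩ O) = μ_w P · μ_{w'} (⋃_{a ∈ N} {a ↔ b})`.

(Gladkov arXiv:2408.08457 Lemma 3.1 = Gladkov–Zimin 2024 Lemma 4.2; van den Berg–Häggström–Kahn 2006 Lemma 2.3;
Kozma–Nitzan arXiv:2401.12397 proof of Thm 5: the spatial Markov property of the product measure at the
stopping set "explore the cluster of `o` without entering `A`".)

## Proof

* `P` is determined by the pairs MEETING `W` (`pocketMarkov_determinedBy_pocketEvent`): if `ω, ω'` agree on
  those pairs and `ω ∈ P`, every open-in-`ω` path inside `Aᶜ` from `o` stays in `W(ω) = W`, so it only uses pairs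
  meeting `W` and is open in `ω'`; conversely an open-in-`ω'` path inside `Aᶜ` from `o` never leaves `W` (the
  first pair leaving `W` meets `W`, so it is open in `ω` too and its far end would lie in the pocket).  Hence
  `W(ω') = W`; the first contacts are then read off the open pairs from `W` to `A` (first exit from `W` of a path
  inside `Aᶜ ∪ {a}`), which again meet `W`, so `N(ω') = N`.
* `O` is determined by the pairs INSIDE `Wᶜ` (`DCT16.determinedBy_openConnIn`), so `μ_w (P ∩ O) = μ_w P · μ_w O`
  (`prodBernoulli_real_inter_of_determinedBy_disjoint`), and `μ_w O = μ_{w'} O` since `w = w'` on those pairs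
  (`prodBernoulli_real_eq_of_determinedBy`).
* Under `μ_{w'}` every pair meeting `W` is a.s. closed (`prodBernoulli_ae_forall_notMem`), and then an open path
  from a vertex `a ∉ W` never enters `W`, so `{a ↔ b} = {a ↔ b inside Wᶜ}` a.s.; realised data have `N ∩ W = ∅`
  (`N ⊆ A`, `W ⊆ Aᶜ`), so `μ_{w'} O = μ_{w'} (⋃_{a ∈ N} {a ↔ b})` (`measureReal_congr`); unrealised data give
  `P = ∅` and `0 = 0`.
-/

namespace Summit.CriticalPhenomena.PercolationContinuityZ3.Theorems

open MeasureTheory Literature.Probability.LatticeModels Literature.Probability.Percolation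
open scoped Classical BigOperators

open Literature.Probability.Percolation.DCT16 (pathIn_of_mem_openConnIn mem_openConnIn_of_pathIn
  reachable_of_pathIn pathIn_induction determinedBy_openConnIn)

/-! ### Combinatorics of the pocket: transfer between configurations agreeing on the pairs meeting `W` -/

/-- **Transfer of pocket paths.** If every `ω`-reachable-inside-`S` vertex (from `o`) lies in `W`, and every
pair from `W` that is open in `ω₁` is open in both `ω` and `ω'`, then an `ω₁`-open path inside `S` from `o`
(for `ω₁ = ω` or `ω₁ = ω'`) is open in both `ω` and `ω'`: by induction along the path, each of its vertices is
reached in `ω`, hence lies in `W`, hence the next pair meets `W`. [folklore] -/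
theorem pocketMarkov_reach_transfer {n : ℕ} {S : Set (Fin n)} {W : Finset (Fin n)} {o : Fin n}
    {ω ω' ω₁ : BondConfig (Fin n)}
    (hWω : ∀ u, ω ∈ openConnIn S o u → u ∈ W)
    (h1 : ∀ x ∈ W, ∀ y, s(x, y) ∈ ω₁ → s(x, y) ∈ ω ∧ s(x, y) ∈ ω')
    {v : Fin n} (hv : ω₁ ∈ openConnIn S o v) :
    ω ∈ openConnIn S o v ∧ ω' ∈ openConnIn S o v := by
  have hp : PathIn (openGraph ω₁) S o v := pathIn_of_mem_openConnIn hv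
  have ho : o ∈ S := hp.left_mem
  refine pathIn_induction (fun u => ω ∈ openConnIn S o u ∧ ω' ∈ openConnIn S o u) hp
    ⟨mem_openConnIn_of_pathIn (PathIn.refl ho), mem_openConnIn_of_pathIn (PathIn.refl ho)⟩ ?_
  rintro x y hx hy ⟨hωx, hω'x⟩ hadj
  obtain ⟨hxy, hne⟩ := (openGraph_adj ω₁ x y).1 hadj
  obtain ⟨hxyω, hxyω'⟩ := h1 x (hWω x hωx) y hxy
  exact ⟨mem_openConnIn_of_pathIn ((pathIn_of_mem_openConnIn hωx).tail
      ((openGraph_adj ω x y).2 ⟨hxyω, hne⟩) hy),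
    mem_openConnIn_of_pathIn ((pathIn_of_mem_openConnIn hω'x).tail
      ((openGraph_adj ω' x y).2 ⟨hxyω', hne⟩) hy)⟩

/-- **Transfer of first contacts.** If `ω` and `ω'` have the same `A`-avoiding pocket `W` of `o` and the same open
pairs from `W`, then a first contact of `ω` is a first contact of `ω'`: an `ω`-open path inside `Aᶜ ∪ {a}` from
`o` to `a ∈ A` leaves `W` a first time through an open pair `{x, y}`, `x ∈ W`; `y ∈ Aᶜ` would put `y` in the
pocket, so `y = a`, and `o ↔ x` inside `Aᶜ` in `ω'` followed by the pair `{x, a}` (open in `ω'`) is the required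
`ω'`-path. [folklore] -/
theorem pocketMarkov_contacts_transfer {n : ℕ} {A W : Finset (Fin n)} {o a : Fin n}
    {ω ω' : BondConfig (Fin n)}
    (hWω : ∀ u, ω ∈ openConnIn ((↑A : Set (Fin n))ᶜ) o u ↔ u ∈ W)
    (hWω' : ∀ u, ω' ∈ openConnIn ((↑A : Set (Fin n))ᶜ) o u ↔ u ∈ W)
    (hF : ∀ x ∈ W, ∀ y, s(x, y) ∈ ω → s(x, y) ∈ ω') (ha : a ∈ A)
    (h : ω ∈ openConnIn (insert a ((↑A : Set (Fin n))ᶜ)) o a) :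
    ω' ∈ openConnIn (insert a ((↑A : Set (Fin n))ᶜ)) o a := by
  by_cases hao : o = a
  · subst hao
    exact mem_openConnIn_of_pathIn (PathIn.refl (Set.mem_insert _ _))
  have hp : PathIn (openGraph ω) (insert a ((↑A : Set (Fin n))ᶜ)) o a := pathIn_of_mem_openConnIn h
  have hoA : o ∈ ((↑A : Set (Fin n))ᶜ) := by
    rcases (Set.mem_insert_iff.1 hp.left_mem) with h' | h'
    · exact absurd h' hao
    · exact h'
  have hoW : o ∈ (↑W : Set (Fin n)) :=
    Finset.mem_coe.2 ((hWω o).1 (mem_openConnIn_of_pathIn (PathIn.refl hoA)))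
  rcases hp.exit_or hoW with hq | ⟨x, y, hx, hy, hyS, hadj, -⟩
  · -- the path stays inside `W`, so `a ∈ W ⊆ Aᶜ`: impossible
    have haW : a ∈ W := Finset.mem_coe.1 hq.right_mem.1
    obtain ⟨-, haA, -⟩ := (hWω a).2 haW
    exact absurd (Finset.mem_coe.2 ha) haA
  · have hxW : x ∈ W := Finset.mem_coe.1 hx
    obtain ⟨hxy, hne⟩ := (openGraph_adj ω x y).1 hadj
    have hya : y = a := by
      rcases Set.mem_insert_iff.1 hyS with h' | hyA
      · exact h'
      · -- `y ∈ Aᶜ` would put `y` in the pocket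
        exact absurd (Finset.mem_coe.2 ((hWω y).1 (mem_openConnIn_of_pathIn
          ((pathIn_of_mem_openConnIn ((hWω x).2 hxW)).tail hadj hyA)))) hy
    subst hya
    have hadj' : (openGraph ω').Adj x y := (openGraph_adj ω' x y).2 ⟨hF x hxW y hxy, hne⟩
    exact mem_openConnIn_of_pathIn
      (((pathIn_of_mem_openConnIn ((hWω' x).2 hxW)).mono (Set.subset_insert _ _)).tail hadj'
        (Set.mem_insert _ _))

/-- **Transfer of the pocket event.** If `ω` and `ω'` have the same open pairs from `W` and `ω` has pocket data
`(W, N)`, then so does `ω'`. [folklore] -/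
theorem pocketMarkov_pocketEvent_transfer {n : ℕ} (A : Finset (Fin n)) (o : Fin n) (W N : Finset (Fin n))
    {ω ω' : BondConfig (Fin n)} (hF : ∀ x ∈ W, ∀ y, (s(x, y) ∈ ω ↔ s(x, y) ∈ ω'))
    (hω : (Finset.univ.filter fun v => ω ∈ openConnIn ((↑A : Set (Fin n))ᶜ) o v) = W ∧
      (A.filter fun a => ω ∈ openConnIn (insert a ((↑A : Set (Fin n))ᶜ)) o a) = N) :
    (Finset.univ.filter fun v => ω' ∈ openConnIn ((↑A : Set (Fin n))ᶜ) o v) = W ∧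
      (A.filter fun a => ω' ∈ openConnIn (insert a ((↑A : Set (Fin n))ᶜ)) o a) = N := by
  obtain ⟨hW, hN⟩ := hω
  have hWω : ∀ u, ω ∈ openConnIn ((↑A : Set (Fin n))ᶜ) o u ↔ u ∈ W := fun u => by
    rw [← hW, Finset.mem_filter]
    exact ⟨fun h => ⟨Finset.mem_univ _, h⟩, fun h => h.2⟩
  have hWω1 : ∀ u, ω ∈ openConnIn ((↑A : Set (Fin n))ᶜ) o u → u ∈ W := fun u => (hWω u).1
  have hWω' : ∀ u, ω' ∈ openConnIn ((↑A : Set (Fin n))ᶜ) o u ↔ u ∈ W := fun u =>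
    ⟨fun hu => (hWω u).1 (pocketMarkov_reach_transfer (ω' := ω') hWω1
        (fun x hx y hxy => ⟨(hF x hx y).2 hxy, hxy⟩) hu).1,
      fun hu => (pocketMarkov_reach_transfer (ω' := ω') hWω1
        (fun x hx y hxy => ⟨hxy, (hF x hx y).1 hxy⟩) ((hWω u).2 hu)).2⟩
  refine ⟨?_, ?_⟩
  · ext u
    rw [Finset.mem_filter]
    exact ⟨fun h => (hWω' u).1 h.2, fun h => ⟨Finset.mem_univ _, (hWω' u).2 h⟩⟩
  · rw [← hN]
    exact Finset.filter_congr fun a ha =>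
      ⟨pocketMarkov_contacts_transfer hWω' hWω (fun x hx y => (hF x hx y).2) ha,
        pocketMarkov_contacts_transfer hWω hWω' (fun x hx y => (hF x hx y).1) ha⟩

/-- **The pocket event `{W(ω) = W, N(ω) = N}` is determined by the pairs meeting `W`.** [folklore; Gladkov
arXiv:2408.08457 Lemma 3.1] -/
theorem pocketMarkov_determinedBy_pocketEvent {n : ℕ} (A : Finset (Fin n)) (o : Fin n) (W N : Finset (Fin n)) :
    DeterminedBy
      {ω : BondConfig (Fin n) |
        (Finset.univ.filter fun v => ω ∈ openConnIn ((↑A : Set (Fin n))ᶜ) o v) = W ∧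
        (A.filter fun a => ω ∈ openConnIn (insert a ((↑A : Set (Fin n))ᶜ)) o a) = N}
      (↑(Finset.univ.filter fun e : Sym2 (Fin n) => ∃ x ∈ W, x ∈ e) : Set (Sym2 (Fin n))) := by
  rw [determinedBy_iff]
  intro ω ω' h
  have hmem : ∀ x ∈ W, ∀ y : Fin n, (s(x, y) ∈ ω ↔ s(x, y) ∈ ω') := by
    intro x hx y
    have he : s(x, y) ∈
        (↑(Finset.univ.filter fun e : Sym2 (Fin n) => ∃ x ∈ W, x ∈ e) : Set (Sym2 (Fin n))) := by
      rw [Finset.coe_filter]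
      exact ⟨Finset.mem_univ _, x, hx, Sym2.mem_mk_left x y⟩
    exact ⟨fun h1 => ((Set.ext_iff.1 h _).1 ⟨h1, he⟩).1, fun h1 => ((Set.ext_iff.1 h _).2 ⟨h1, he⟩).1⟩
  exact ⟨pocketMarkov_pocketEvent_transfer A o W N hmem,
    pocketMarkov_pocketEvent_transfer A o W N fun x hx y => (hmem x hx y).symm⟩

/-- **The off-pocket connection `⋃_{a ∈ N} {a ↔ b inside Wᶜ}` is determined by the pairs inside `Wᶜ`.**
[folklore; Grimmett 1999 §2.2] -/
theorem pocketMarkov_determinedBy_offPocket {n : ℕ} (W N : Finset (Fin n)) (b : Fin n) :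
    DeterminedBy (⋃ a ∈ N, openConnIn ((↑W : Set (Fin n))ᶜ) a b : Set (BondConfig (Fin n)))
      (↑(Finset.univ.filter fun e : Sym2 (Fin n) => ∀ x ∈ e, x ∉ W) : Set (Sym2 (Fin n))) := by
  have hK : ((↑W : Set (Fin n))ᶜ).sym2 ⊆
      (↑(Finset.univ.filter fun e : Sym2 (Fin n) => ∀ x ∈ e, x ∉ W) : Set (Sym2 (Fin n))) := by
    intro e he
    rw [Finset.coe_filter]
    exact ⟨Finset.mem_univ _, fun x hx => Set.mem_sym2_iff_subset.1 he hx⟩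
  rw [determinedBy_iff]
  intro ω ω' h
  simp only [Set.mem_iUnion, exists_prop]
  exact exists_congr fun a => and_congr_right fun _ =>
    (determinedBy_iff _ _).1 (determinedBy_openConnIn ((↑W : Set (Fin n))ᶜ) a b hK) ω ω' h

/-- **Deleting the pocket.** If every pair meeting `W` is closed in `ω`, then an open path from a vertex `a ∉ W`
never enters `W`: `ω ∈ {a ↔ b} ↔ ω ∈ {a ↔ b inside Wᶜ}`. [folklore] -/
theorem pocketMarkov_openConn_iff_openConnIn_of_closed {n : ℕ} {W : Finset (Fin n)} {ω : BondConfig (Fin n)}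
    (hω : ∀ x ∈ W, ∀ y : Fin n, s(x, y) ∉ ω) {a : Fin n} (ha : a ∉ W) (b : Fin n) :
    ω ∈ openConn a b ↔ ω ∈ openConnIn ((↑W : Set (Fin n))ᶜ) a b := by
  refine ⟨fun hab => ?_, fun h => reachable_of_pathIn (pathIn_of_mem_openConnIn h)⟩
  have hout : ∀ y : Fin n, (openGraph ω).Reachable a y → y ∈ ((↑W : Set (Fin n))ᶜ) := by
    intro y hy hyW
    rw [SimpleGraph.reachable_iff_reflTransGen] at hy
    induction hy with
    | refl => exact ha (Finset.mem_coe.1 hyW)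
    | @tail x z _ hxz ih =>
      obtain ⟨hxzω, -⟩ := (openGraph_adj ω x z).1 hxz
      by_cases hxW : x ∈ (↑W : Set (Fin n))
      · exact ih hxW
      · rw [Sym2.eq_swap] at hxzω
        exact hω z (Finset.mem_coe.1 hyW) x hxzω
  apply mem_openConnIn_of_pathIn
  have hr : (openGraph ω).Reachable a b := hab
  rw [SimpleGraph.reachable_iff_reflTransGen] at hr
  refine ⟨hout a (SimpleGraph.Reachable.refl a), ?_⟩
  clear hab
  induction hr with
  | refl => exact Relation.ReflTransGen.refl
  | @tail x y hax hxy ih =>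
    exact ih.tail ⟨hxy, hout y ((SimpleGraph.reachable_iff_reflTransGen _ _).2 (hax.tail hxy))⟩

/-! ### The registered stub -/

/-- Registered stub `stub_pocketMarkov` of crux stmt-CriticalPhenomena-4576 (line replica-splice-at-entrance):
**spatial Markov property at the entrance stopping set.** With `W(ω) := {v | o ↔ v inside Aᶜ}` (the
`A`-avoiding pocket) and `N(ω) := {a ∈ A | o ↔ a inside Aᶜ ∪ {a}}` (first contacts), for all data `(W, N)`:
`μ_w ({W(ω) = W, N(ω) = N} ∩ ⋃_{a ∈ N} {a ↔ b inside Wᶜ}) = μ_w {W(ω) = W, N(ω) = N} · μ_{w'} (⋃_{a ∈ N} {a ↔ b})`,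
where `w'` is `w` with the pairs meeting `W` given weight `0` — the pocket event is determined by the pairs meeting
`W`, the off-pocket connection by the pairs inside `Wᶜ` (independent under the product measure, same law under `w`
and `w'`), and under `w'` the pairs meeting `W` are a.s. closed so `{a ↔ b} = {a ↔ b inside Wᶜ}` a.s. for the
realised contacts `a ∈ N ⊆ Wᶜ`. [folklore; Gladkov arXiv:2408.08457 Lemma 3.1 (= Gladkov–Zimin 2024 Lemma 4.2),
van den Berg–Häggström–Kahn 2006 Lemma 2.3, Kozma–Nitzan arXiv:2401.12397 proof of Thm 5] -/
theorem stub_pocketMarkov :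
    ∀ (n : ℕ) (w : Sym2 (Fin n) → unitInterval) (A : Finset (Fin n)) (o b : Fin n) (W N : Finset (Fin n)),
      (prodBernoulli w).real
          ({ω : BondConfig (Fin n) |
              (Finset.univ.filter fun v => ω ∈ openConnIn ((↑A : Set (Fin n))ᶜ) o v) = W ∧
              (A.filter fun a => ω ∈ openConnIn (insert a ((↑A : Set (Fin n))ᶜ)) o a) = N} ∩
            ⋃ a ∈ N, openConnIn ((↑W : Set (Fin n))ᶜ) a b) =
        (prodBernoulli w).real
            {ω : BondConfig (Fin n) |
              (Finset.univ.filter fun v => ω ∈ openConnIn ((↑A : Set (Fin n))ᶜ) o v) = W ∧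
              (A.filter fun a => ω ∈ openConnIn (insert a ((↑A : Set (Fin n))ᶜ)) o a) = N} *
          (prodBernoulli (fun e : Sym2 (Fin n) => if ∃ v ∈ W, v ∈ e then (0 : unitInterval) else w e)).real
            (⋃ a ∈ N, openConn a b) := by
  intro n w A o b W N
  set P : Set (BondConfig (Fin n)) :=
    {ω : BondConfig (Fin n) |
      (Finset.univ.filter fun v => ω ∈ openConnIn ((↑A : Set (Fin n))ᶜ) o v) = W ∧
      (A.filter fun a => ω ∈ openConnIn (insert a ((↑A : Set (Fin n))ᶜ)) o a) = N} with hP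
  set O : Set (BondConfig (Fin n)) := ⋃ a ∈ N, openConnIn ((↑W : Set (Fin n))ᶜ) a b with hO
  set w' : Sym2 (Fin n) → unitInterval :=
    fun e : Sym2 (Fin n) => if ∃ v ∈ W, v ∈ e then (0 : unitInterval) else w e with hw'
  set F : Finset (Sym2 (Fin n)) := Finset.univ.filter fun e : Sym2 (Fin n) => ∃ x ∈ W, x ∈ e with hF
  set F' : Finset (Sym2 (Fin n)) := Finset.univ.filter fun e : Sym2 (Fin n) => ∀ x ∈ e, x ∉ W with hF'
  have hdisj : Disjoint F F' := by
    rw [Finset.disjoint_left]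
    intro e he he'
    obtain ⟨x, hxW, hxe⟩ := (Finset.mem_filter.1 he).2
    exact (Finset.mem_filter.1 he').2 x hxe hxW
  have hPdet : DeterminedBy P (↑F : Set (Sym2 (Fin n))) := pocketMarkov_determinedBy_pocketEvent A o W N
  have hOdet : DeterminedBy O (↑F' : Set (Sym2 (Fin n))) := pocketMarkov_determinedBy_offPocket W N b
  -- (1) independence of `P` (pairs meeting `W`) and `O` (pairs inside `Wᶜ`)
  have step1 : (prodBernoulli w).real (P ∩ O) = (prodBernoulli w).real P * (prodBernoulli w).real O :=
    prodBernoulli_real_inter_of_determinedBy_disjoint w hdisj hPdet hOdet (Set.toFinite _).measurableSet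
      (Set.toFinite _).measurableSet
  -- (2) `O` has the same probability under `w` and `w'` (they agree on the pairs inside `Wᶜ`)
  have step2 : (prodBernoulli w).real O = (prodBernoulli w').real O := by
    refine prodBernoulli_real_eq_of_determinedBy w w' (F := (↑F' : Set (Sym2 (Fin n)))) (fun e he => ?_)
      hOdet (Set.toFinite _).measurableSet
    have he' : ∀ x ∈ e, x ∉ W := (Finset.mem_filter.1 (Finset.mem_coe.1 he)).2
    have hne : ¬ ∃ v ∈ W, v ∈ e := fun ⟨v, hvW, hve⟩ => he' v hve hvW
    simp only [hw', if_neg hne]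
  rw [step1, step2]
  rcases Set.eq_empty_or_nonempty P with hPe | ⟨ω₀, hω₀⟩
  · rw [hPe, measureReal_empty, zero_mul, zero_mul]
  -- realised data: `N ⊆ A` and `W ⊆ Aᶜ`, so `N ∩ W = ∅`
  have hNW : ∀ a ∈ N, a ∉ W := by
    intro a haN haW
    obtain ⟨hW0, hN0⟩ := hω₀
    rw [← hN0] at haN
    rw [← hW0] at haW
    obtain ⟨-, haA, -⟩ := (Finset.mem_filter.1 haW).2
    exact haA (Finset.mem_coe.2 (Finset.mem_filter.1 haN).1)
  congr 1
  -- (3) under `w'` the pairs meeting `W` are a.s. closed, so `O = ⋃_{a ∈ N} {a ↔ b}` a.s.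
  apply measureReal_congr
  have hae : ∀ᵐ ω ∂prodBernoulli w', ∀ e ∈ (↑F : Set (Sym2 (Fin n))), e ∉ ω := by
    refine prodBernoulli_ae_forall_notMem w' F.countable_toSet fun e he => ?_
    have he' : ∃ x ∈ W, x ∈ e := (Finset.mem_filter.1 (Finset.mem_coe.1 he)).2
    simp only [hw', if_pos he']
  refine Filter.eventuallyEq_set.2 ?_
  filter_upwards [hae] with ω hω
  have hω' : ∀ x ∈ W, ∀ y : Fin n, s(x, y) ∉ ω := fun x hx y =>
    hω _ (Finset.mem_coe.2 (Finset.mem_filter.2 ⟨Finset.mem_univ _, x, hx, Sym2.mem_mk_left x y⟩))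
  simp only [hO, Set.mem_iUnion, exists_prop]
  exact exists_congr fun a => ⟨fun h => ⟨h.1,
      (pocketMarkov_openConn_iff_openConnIn_of_closed hω' (hNW a h.1) b).2 h.2⟩,
    fun h => ⟨h.1, (pocketMarkov_openConn_iff_openConnIn_of_closed hω' (hNW a h.1) b).1 h.2⟩⟩

end Summit.CriticalPhenomena.PercolationContinuityZ3.Theorems
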